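/-
Copyright (c) 2026. All rights reserved.
Released under Apache 2.0 license as described in the file LICENSE.
Authors: abc-iut cell, seat abc-iut-w6-d067 (gen 5).
-/
import Literature.AnabelianGeometry.AbsoluteAnabelian.NFGaloisNotTFGProofs
import Literature.GroupTheory.InfiniteCharactersNotStronglyComplete
import Literature.NumberTheory.GaloisRepresentations.AbsGaloisGroup
import Mathlib.GroupTheory.IndexNormal
import HarnessLib

/-!
# The absolute Galois group of a number field is not strongly complete

[AbsTopI] Thm. 1.7 (iii) p. 14 (S. Mochizuki, *Topics in absolute anabelian geometry I*): "if `k` is an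
NF, then `G_k` is very elastic" — in particular NOT topologically finitely generated; the tree proves the
latter by counting quadratic extensions: `Gal(F̄/F)` has INFINITELY many open subgroups of index `2`
(`infinite_setOf_isOpen_index_two_gal`, abc-iut-L4-t8, `NFGaloisNotTFGProofs.lean`).  This proof-only
sequel (0 definitions) draws the strong-completeness consequence through
`Literature/GroupTheory/InfiniteCharactersNotStronglyComplete.lean` (abc-iut-w6-d067): a compact group
with infinitely many open normal subgroups of index `p` maps continuously ONTO `(ℤ/p)^ℕ` and therefore has
a finite-index subgroup which is NOT open.  Hence, for every number field `F`:

* `exists_continuous_surjective_gal_pi_zmod_two` — a continuous surjection `Gal(F̄/F) ↠ (ℤ/2)^ℕ`;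
* `exists_finiteIndex_not_isOpen_gal` / `not_forall_finiteIndex_isOpen_gal` — `Gal(F̄/F)` has a subgroup
  of finite index which is not open: **`G_F` is NOT strongly complete** (so the conclusion of the
  Nikolov–Segal theorem — named fact `Literature.GroupTheory.NikolovSegalStatement`, FACT-LIST F-1977 in
  the `ProfiniteGrp` form — genuinely FAILS for `G_F`, not merely its hypothesis; contrast the `p`-adic
  local case, where `G_k` is topologically finitely generated);
* `exists_monoidHom_zmod_two_not_continuous_gal` — equivalently, `Gal(F̄/F)` admits a DISCONTINUOUS
  homomorphism onto `ℤ/2` (a "quadratic character" attached to no quadratic extension);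
* the same three statements for Mathlib's `Field.absoluteGaloisGroup F` (transport along the identity
  `absoluteGaloisGroup.toAlgEquiv`).

Classical (folklore around [AbsTopI] Thm. 1.7 (iii); cf. L. Ribes, P. Zalesskii, *Profinite Groups*
§4.2 on strong completeness, and J.-P. Serre, *Cohomologie galoisienne* I §4.2).  No side taken on
[IUTchIII] Cor. 3.12; nothing here is specific to IUT.

[cite: MochizukiAbsTopI2012, Thm 1.7 (iii) p.14] [cite: RibesZalesskii2010, §4.2]
-/

noncomputable section

namespace Literature.AnabelianGeometry.AbsoluteAnabelian

open Field Topology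

universe u

/-! ### Plumbing: characters from index-`p` normal subgroups; discrete `ℤ/2` -/

/-- A normal subgroup of prime index `p` is the kernel of a homomorphism onto `ℤ/p` (`G ⧸ N` is cyclic
of order `p`).  Private plumbing (the same device as in `InfiniteCharactersNotStronglyComplete.lean`).
[folklore] -/
private theorem exists_character_ker_eq {G : Type u} [Group G] {p : ℕ} [Fact p.Prime]
    (N : Subgroup G) [N.Normal] (hN : N.index = p) :
    ∃ ψ : G →* Multiplicative (ZMod p), ψ.ker = N := by
  haveI : Fact (Nat.card (G ⧸ N)).Prime := by rw [← Subgroup.index, hN]; infer_instance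
  haveI : IsCyclic (G ⧸ N) := isCyclic_of_prime_card (p := Nat.card (G ⧸ N)) rfl
  have hcard : Nat.card (G ⧸ N) = Nat.card (Multiplicative (ZMod p)) := by
    rw [← Subgroup.index, hN, Nat.card_eq_fintype_card]
    simp
  refine ⟨(mulEquivOfCyclicCardEq hcard).toMonoidHom.comp (QuotientGroup.mk' N), ?_⟩
  ext g
  simp only [MonoidHom.mem_ker, MonoidHom.coe_comp, MulEquiv.coe_toMonoidHom, Function.comp_apply,
    QuotientGroup.mk'_apply, EmbeddingLike.map_eq_one_iff, QuotientGroup.eq_one_iff]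

/-- From infinitely many open normal subgroups of index `p` to infinitely many open-kernel characters
to `ℤ/p`.  Private plumbing. [folklore] -/
private theorem infinite_characters_of_infinite_openNormal {G : Type u} [Group G] [TopologicalSpace G]
    {p : ℕ} [Fact p.Prime]
    (hinf : Set.Infinite {N : Subgroup G | N.Normal ∧ IsOpen (N : Set G) ∧ N.index = p}) :
    Set.Infinite {ψ : G →* Multiplicative (ZMod p) | IsOpen (ψ.ker : Set G)} := by
  classical
  have hch : ∀ N : {N : Subgroup G | N.Normal ∧ IsOpen (N : Set G) ∧ N.index = p},
      ∃ ψ : G →* Multiplicative (ZMod p), ψ.ker = N.1 := by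
    rintro ⟨N, hNn, -, hNi⟩
    haveI := hNn
    exact exists_character_ker_eq N hNi
  choose ψ hψ using hch
  have hinj : Function.Injective ψ := by
    intro N N' he
    apply Subtype.ext
    rw [← hψ N, ← hψ N', he]
  haveI : Infinite {N : Subgroup G | N.Normal ∧ IsOpen (N : Set G) ∧ N.index = p} := hinf.to_subtype
  refine (Set.infinite_range_of_injective hinj).mono ?_
  rintro _ ⟨N, rfl⟩
  change IsOpen ((ψ N).ker : Set G)
  rw [hψ N]
  exact N.2.2.1

/-! ### `Gal(F̄/F)` for a number field `F` -/

section Gal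

variable (F : Type u) [Field F] [NumberField F]

/-- For a number field `F`, `Gal(F̄/F)` has infinitely many OPEN NORMAL subgroups of index `2` (the
quadratic extensions `F(√p)`; index `2` subgroups are normal).
[cite: MochizukiAbsTopI2012, Thm 1.7 (iii) p.14] -/
theorem infinite_setOf_openNormal_index_two_gal :
    {N : Subgroup (AlgebraicClosure F ≃ₐ[F] AlgebraicClosure F) |
      N.Normal ∧ IsOpen (N : Set (AlgebraicClosure F ≃ₐ[F] AlgebraicClosure F)) ∧ N.index = 2}.Infinite := by
  have h := infinite_setOf_isOpen_index_two_gal F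
  have e : {N : Subgroup (AlgebraicClosure F ≃ₐ[F] AlgebraicClosure F) |
        N.Normal ∧ IsOpen (N : Set (AlgebraicClosure F ≃ₐ[F] AlgebraicClosure F)) ∧ N.index = 2} =
      {H : Subgroup (AlgebraicClosure F ≃ₐ[F] AlgebraicClosure F) |
        IsOpen (H : Set (AlgebraicClosure F ≃ₐ[F] AlgebraicClosure F)) ∧ H.index = 2} := by
    ext H
    simp only [Set.mem_setOf_eq]
    exact ⟨fun h => h.2, fun h => ⟨Subgroup.normal_of_index_eq_two h.2, h⟩⟩
  rw [e]
  exact h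

/-- **`Gal(F̄/F)` maps continuously ONTO `(ℤ/2)^ℕ`** (product of discrete topologies), for every number
field `F`. [cite: MochizukiAbsTopI2012, Thm 1.7 (iii) p.14] -/
theorem exists_continuous_surjective_gal_pi_zmod_two [TopologicalSpace (ZMod 2)]
    [DiscreteTopology (ZMod 2)] :
    ∃ π : (AlgebraicClosure F ≃ₐ[F] AlgebraicClosure F) →* Multiplicative (ℕ → ZMod 2),
      Continuous π ∧ Function.Surjective π := by
  haveI : Fact (Nat.Prime 2) := ⟨Nat.prime_two⟩
  exact Literature.GroupTheory.exists_continuous_surjective_pi_zmod_of_infinite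
    (infinite_characters_of_infinite_openNormal (infinite_setOf_openNormal_index_two_gal F))

/-- **The absolute Galois group of a number field is NOT strongly complete**: `Gal(F̄/F)` has a subgroup
of finite index which is not open (for the Krull topology). [cite: MochizukiAbsTopI2012, Thm 1.7 (iii) p.14]
[cite: RibesZalesskii2010, §4.2] -/
theorem exists_finiteIndex_not_isOpen_gal :
    ∃ V : Subgroup (AlgebraicClosure F ≃ₐ[F] AlgebraicClosure F),
      V.FiniteIndex ∧ ¬ IsOpen (V : Set (AlgebraicClosure F ≃ₐ[F] AlgebraicClosure F)) := by
  haveI : Fact (Nat.Prime 2) := ⟨Nat.prime_two⟩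
  exact Literature.GroupTheory.exists_finiteIndex_not_isOpen_of_infinite_openNormal_index_eq (p := 2)
    (infinite_setOf_openNormal_index_two_gal F)

/-- **`Gal(F̄/F)` is not strongly complete** (negated universal form: it is false that every finite-index
subgroup is open). [cite: MochizukiAbsTopI2012, Thm 1.7 (iii) p.14] [cite: RibesZalesskii2010, §4.2] -/
theorem not_forall_finiteIndex_isOpen_gal :
    ¬ ∀ V : Subgroup (AlgebraicClosure F ≃ₐ[F] AlgebraicClosure F),
        V.FiniteIndex → IsOpen (V : Set (AlgebraicClosure F ≃ₐ[F] AlgebraicClosure F)) := by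
  obtain ⟨V, hV, hVo⟩ := exists_finiteIndex_not_isOpen_gal F
  exact fun h => hVo (h V hV)

/-- **`Gal(F̄/F)` admits a DISCONTINUOUS homomorphism onto `ℤ/2`**: the preimage under
`Gal(F̄/F) ↠ (ℤ/2)^ℕ` of a non-open index-`2` subgroup of `(ℤ/2)^ℕ` is a non-open normal subgroup of
index `2`, the kernel of a quadratic character which is not continuous (belongs to no quadratic
extension). [cite: MochizukiAbsTopI2012, Thm 1.7 (iii) p.14] [cite: RibesZalesskii2010, §4.2] -/
theorem exists_monoidHom_zmod_two_not_continuous_gal [TopologicalSpace (ZMod 2)]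
    [DiscreteTopology (ZMod 2)] :
    ∃ φ : (AlgebraicClosure F ≃ₐ[F] AlgebraicClosure F) →* Multiplicative (ZMod 2),
      ¬ Continuous φ := by
  classical
  haveI : Fact (Nat.Prime 2) := ⟨Nat.prime_two⟩
  obtain ⟨π, hπ, hsurj⟩ := exists_continuous_surjective_gal_pi_zmod_two F
  -- a non-open index-2 subgroup of `(ℤ/2)^ℕ`, pulled back along `π`
  haveI : Finite (ZMod 2) := Finite.of_fintype _
  obtain ⟨U, hUi, hUo⟩ := Literature.GroupTheory.exists_index_eq_not_isOpen_pi (ZMod 2)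
  let W : Subgroup (Multiplicative (ℕ → ZMod 2)) := U.toSubgroup
  have hWi : W.index = 2 := by
    rw [AddSubgroup.index_toSubgroup, hUi, Nat.card_eq_fintype_card, ZMod.card]
  have hWo : ¬ IsOpen (W : Set (Multiplicative (ℕ → ZMod 2))) := hUo
  haveI : T2Space (Multiplicative (ℕ → ZMod 2)) := inferInstanceAs (T2Space (ℕ → ZMod 2))
  have hVo := Literature.GroupTheory.not_isOpen_comap_of_surjective π hπ hsurj W hWo
  have hVi : (W.comap π).index = 2 := by rw [Subgroup.index_comap_of_surjective W hsurj, hWi]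
  haveI : (W.comap π).Normal := Subgroup.normal_of_index_eq_two hVi
  obtain ⟨φ, hφ⟩ := exists_character_ker_eq (W.comap π) hVi
  refine ⟨φ, fun hc => hVo ?_⟩
  rw [← hφ]
  have : (φ.ker : Set (AlgebraicClosure F ≃ₐ[F] AlgebraicClosure F)) = φ ⁻¹' {1} := by
    ext g
    simp [MonoidHom.mem_ker]
  rw [this]
  exact (isOpen_discrete _).preimage hc

end Gal

/-! ### Mathlib's `Field.absoluteGaloisGroup F` -/

section AbsoluteGaloisGroup

variable (F : Type u) [Field F] [NumberField F]

/-- **`Field.absoluteGaloisGroup F` is not strongly complete**, `F` a number field: a finite-index subgroup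
that is not open (transport along the identity `absoluteGaloisGroup.toAlgEquiv`).
[cite: MochizukiAbsTopI2012, Thm 1.7 (iii) p.14] [cite: RibesZalesskii2010, §4.2] -/
theorem exists_finiteIndex_not_isOpen_absoluteGaloisGroup :
    ∃ V : Subgroup (absoluteGaloisGroup F), V.FiniteIndex ∧ ¬ IsOpen (V : Set (absoluteGaloisGroup F)) :=
  exists_finiteIndex_not_isOpen_gal F

/-- `Field.absoluteGaloisGroup F` admits a discontinuous homomorphism onto `ℤ/2`, `F` a number field.
[cite: MochizukiAbsTopI2012, Thm 1.7 (iii) p.14] [cite: RibesZalesskii2010, §4.2] -/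
theorem exists_monoidHom_zmod_two_not_continuous_absoluteGaloisGroup [TopologicalSpace (ZMod 2)]
    [DiscreteTopology (ZMod 2)] :
    ∃ φ : absoluteGaloisGroup F →* Multiplicative (ZMod 2), ¬ Continuous φ :=
  exists_monoidHom_zmod_two_not_continuous_gal F

/-- `Field.absoluteGaloisGroup F` maps continuously onto `(ℤ/2)^ℕ`, `F` a number field.
[cite: MochizukiAbsTopI2012, Thm 1.7 (iii) p.14] -/
theorem exists_continuous_surjective_absoluteGaloisGroup_pi_zmod_two [TopologicalSpace (ZMod 2)]
    [DiscreteTopology (ZMod 2)] :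
    ∃ π : absoluteGaloisGroup F →* Multiplicative (ℕ → ZMod 2), Continuous π ∧ Function.Surjective π :=
  exists_continuous_surjective_gal_pi_zmod_two F

end AbsoluteGaloisGroup

/-! ### Appendix (v2, append-only): a non-open subgroup of index exactly `2` -/

section IndexTwo

variable (F : Type u) [Field F] [NumberField F]

/-- **`Gal(F̄/F)` has a NON-open subgroup of index exactly `2`** (normal, since of index `2`): the preimage
under `Gal(F̄/F) ↠ (ℤ/2)^ℕ` of a non-open index-`2` subgroup of `(ℤ/2)^ℕ` — a «quadratic character attached
to no quadratic extension», in subgroup form. [cite: MochizukiAbsTopI2012, Thm 1.7 (iii) p.14]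
[cite: RibesZalesskii2010, §4.2] -/
theorem exists_index_two_not_isOpen_gal :
    ∃ V : Subgroup (AlgebraicClosure F ≃ₐ[F] AlgebraicClosure F),
      V.index = 2 ∧ ¬ IsOpen (V : Set (AlgebraicClosure F ≃ₐ[F] AlgebraicClosure F)) := by
  classical
  letI : TopologicalSpace (ZMod 2) := ⊥
  haveI : DiscreteTopology (ZMod 2) := ⟨rfl⟩
  haveI : Fact (Nat.Prime 2) := ⟨Nat.prime_two⟩
  obtain ⟨π, hπ, hsurj⟩ := exists_continuous_surjective_gal_pi_zmod_two F
  haveI : Finite (ZMod 2) := Finite.of_fintype _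
  obtain ⟨U, hUi, hUo⟩ := Literature.GroupTheory.exists_index_eq_not_isOpen_pi (ZMod 2)
  let W : Subgroup (Multiplicative (ℕ → ZMod 2)) := U.toSubgroup
  have hWi : W.index = 2 := by
    rw [AddSubgroup.index_toSubgroup, hUi, Nat.card_eq_fintype_card, ZMod.card]
  have hWo : ¬ IsOpen (W : Set (Multiplicative (ℕ → ZMod 2))) := hUo
  haveI : T2Space (Multiplicative (ℕ → ZMod 2)) := inferInstanceAs (T2Space (ℕ → ZMod 2))
  refine ⟨W.comap π, ?_, Literature.GroupTheory.not_isOpen_comap_of_surjective π hπ hsurj W hWo⟩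
  rw [Subgroup.index_comap_of_surjective W hsurj, hWi]

/-- The same for `Field.absoluteGaloisGroup F`. [cite: MochizukiAbsTopI2012, Thm 1.7 (iii) p.14] -/
theorem exists_index_two_not_isOpen_absoluteGaloisGroup :
    ∃ V : Subgroup (absoluteGaloisGroup F), V.index = 2 ∧ ¬ IsOpen (V : Set (absoluteGaloisGroup F)) :=
  exists_index_two_not_isOpen_gal F

end IndexTwo

end Literature.AnabelianGeometry.AbsoluteAnabelian

end
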